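/-
Copyright (c) 2026. All rights reserved.
Released under Apache 2.0 license as described in the file LICENSE.
Authors: abc-iut cell — seat abc-iut-w4-d104 (wave 4, D-0067; node AbsTopIII:Prop2.6 bridge to
[AbsTopIII] Prop 2.5 (e)). Proof-only companion to `HolomorphicCores` over abc-iut-L6-t15's
`ParallelogramsPlanar*` files; no new definitions.
-/
import Literature.AnabelianGeometry.AbsoluteAnabelian.ParallelogramsPlanarQuad
import HarnessLib

/-!
# [AbsTopIII] Prop 2.5 (e): the local additive structure `a +_p b` IS the parallelogram sum

S. Mochizuki, *Topics in absolute anabelian geometry III*, Prop. 2.5 (e) (kurims p. 57): for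
`p ∈ U ⊆ ℂ` and `a, b ∈ U` near `p`, the sum `a +_p b` "relative to the origin `p`" is constructed
from the input data `(U, 𝒬(U))` alone: for `a, b ≠ p`, "for `P ∈ 𝒫(U)` such that `P` contains
[distinct] intersecting sides `S_a, S_b` for which `S_a ∩ S_b = {p}`, `∂S_a = {p, a}`, `∂S_b = {p, b}`,
we take `a +_p b` to be the unique endpoint of a side of `P` that `∉ {a, b, p}`".  The statement file
`HolomorphicCores.lean` (abc-iut-L4-t14, p407343) types this as the relation
`Parallelograms.LocalAdd 𝒬 p a b c`.

This file PROVES that the relation is the parallelogram law: for `𝒮(U) ⊆ 𝒬 ⊆ 𝒫(U)` (`U` open) and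
granted the Prop. 2.5 (c) reconstruction `Parallelograms.parallelograms 𝒬 = {P | val '' P ∈ 𝒫(U)}`
(the first clause of `TwoOrientations`; abc-iut-L6-t15's chain — the inclusion `⊆` is the landed
`Parallelograms.parallelograms_subset_of_subset`),

* `Parallelograms.localAdd_pt_left_iff` / `localAdd_pt_right_iff`: `p +_p b = b`, `a +_p p = a`;
* `Parallelograms.coe_eq_of_localAdd`: if `a, b ≠ p` and `LocalAdd 𝒬 p a b c` then
  `(c : ℂ) = a + b − p`, and `a − p`, `b − p` are `ℝ`-linearly independent (the sum is DEFINED only in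
  general position — exactly as printed: `S_a`, `S_b` are distinct intersecting sides).

The converse (existence of the witnessing parallelogram for `a, b` near `p` in general position) is
the sequel `ParallelogramsLocalAddExists.lean`.  Consumed by the Prop. 2.6 germ-group model
(`HolomorphicCoresLocalLinearProofs.lean`, seat abc-iut-w4-d104): "compatible with the local additive
structures" for a germ at `p` = additive near `p` relative to the origin `p`.
Refereed pre-IUT material; nothing here bears on the disputed [IUTchIII] Cor. 3.12.
-/

namespace Literature.AnabelianGeometry.AbsoluteAnabelian

open _root_.Complex _root_.Set _root_.Topology

noncomputable section

/-! ### Combinatorics of the corners `{0,1}²` of the unit square -/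

/-- In `{0, 1}`: `x ≠ s` forces `x = 1 − s`. (Auxiliary.)
[cite: MochizukiAbsTopIII2015, Proposition 2.5 (proof) pp.55–57] -/
theorem eq_one_sub_of_ne_of_mem_zero_one {x s : ℝ} (hx : x = 0 ∨ x = 1) (hs : s = 0 ∨ s = 1)
    (h : x ≠ s) : x = 1 - s := by
  rcases hx with rfl | rfl <;> rcases hs with rfl | rfl <;> norm_num <;> exact h rfl

/-- In `{0, 1}`: every `x` is `s` or `1 − s`. (Auxiliary.)
[cite: MochizukiAbsTopIII2015, Proposition 2.5 (proof) pp.55–57] -/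
theorem eq_or_eq_one_sub_of_mem_zero_one {x s : ℝ} (hx : x = 0 ∨ x = 1) (hs : s = 0 ∨ s = 1) :
    x = s ∨ x = 1 - s := by
  rcases hx with rfl | rfl <;> rcases hs with rfl | rfl <;> norm_num

/-- **The fourth corner.** In the unit square with corner `(s, t)`: if the corners `a = (a₁, a₂)` and
`b = (b₁, b₂)` are the far ends of two DISTINCT edges through `(s, t)` and the corner `c` is none of
`(s,t), a, b`, then `c = a + b − (s, t)` coordinatewise. (Auxiliary.)
[cite: MochizukiAbsTopIII2015, Proposition 2.5 (proof) pp.55–57] -/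
theorem corner_fourth {s t a₁ a₂ b₁ b₂ c₁ c₂ : ℝ} (hs : s = 0 ∨ s = 1) (ht : t = 0 ∨ t = 1)
    (ha₁ : a₁ = 0 ∨ a₁ = 1) (ha₂ : a₂ = 0 ∨ a₂ = 1) (hb₁ : b₁ = 0 ∨ b₁ = 1) (hb₂ : b₂ = 0 ∨ b₂ = 1)
    (hc₁ : c₁ = 0 ∨ c₁ = 1) (hc₂ : c₂ = 0 ∨ c₂ = 1)
    (hap : ¬ (a₁ = s ∧ a₂ = t)) (hae : a₁ = s ∨ a₂ = t)
    (hbp : ¬ (b₁ = s ∧ b₂ = t)) (hbe : b₁ = s ∨ b₂ = t)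
    (hab : ¬ (a₁ = b₁ ∧ a₂ = b₂))
    (hcp : ¬ (c₁ = s ∧ c₂ = t)) (hca : ¬ (c₁ = a₁ ∧ c₂ = a₂)) (hcb : ¬ (c₁ = b₁ ∧ c₂ = b₂)) :
    c₁ = a₁ + b₁ - s ∧ c₂ = a₂ + b₂ - t := by
  -- `a` and `b` are `(1 - s, t)` and `(s, 1 - t)` in some order
  have ha : (a₁ = 1 - s ∧ a₂ = t) ∨ (a₁ = s ∧ a₂ = 1 - t) := by
    rcases hae with h | h
    · exact Or.inr ⟨h, eq_one_sub_of_ne_of_mem_zero_one ha₂ ht fun h' => hap ⟨h, h'⟩⟩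
    · exact Or.inl ⟨eq_one_sub_of_ne_of_mem_zero_one ha₁ hs fun h' => hap ⟨h', h⟩, h⟩
  have hb : (b₁ = 1 - s ∧ b₂ = t) ∨ (b₁ = s ∧ b₂ = 1 - t) := by
    rcases hbe with h | h
    · exact Or.inr ⟨h, eq_one_sub_of_ne_of_mem_zero_one hb₂ ht fun h' => hbp ⟨h, h'⟩⟩
    · exact Or.inl ⟨eq_one_sub_of_ne_of_mem_zero_one hb₁ hs fun h' => hbp ⟨h', h⟩, h⟩
  have hsum : a₁ + b₁ - s = 1 - s ∧ a₂ + b₂ - t = 1 - t := by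
    rcases ha with ⟨rfl, rfl⟩ | ⟨rfl, rfl⟩ <;> rcases hb with ⟨rfl, rfl⟩ | ⟨rfl, rfl⟩
    · exact (hab ⟨rfl, rfl⟩).elim
    · constructor <;> ring
    · constructor <;> ring
    · exact (hab ⟨rfl, rfl⟩).elim
  rw [hsum.1, hsum.2]
  -- `c` is the remaining corner
  rcases eq_or_eq_one_sub_of_mem_zero_one hc₁ hs with hc1 | hc1 <;>
    rcases eq_or_eq_one_sub_of_mem_zero_one hc₂ ht with hc2 | hc2
  · exact (hcp ⟨hc1, hc2⟩).elim
  · rcases ha with ⟨h1, h2⟩ | ⟨h1, h2⟩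
    · rcases hb with ⟨h3, h4⟩ | ⟨h3, h4⟩
      · exact (hab ⟨h1.trans h3.symm, h2.trans h4.symm⟩).elim
      · exact (hcb ⟨hc1.trans h3.symm, hc2.trans h4.symm⟩).elim
    · exact (hca ⟨hc1.trans h1.symm, hc2.trans h2.symm⟩).elim
  · rcases ha with ⟨h1, h2⟩ | ⟨h1, h2⟩
    · exact (hca ⟨hc1.trans h1.symm, hc2.trans h2.symm⟩).elim
    · rcases hb with ⟨h3, h4⟩ | ⟨h3, h4⟩
      · exact (hcb ⟨hc1.trans h3.symm, hc2.trans h4.symm⟩).elim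
      · exact (hab ⟨h1.trans h3.symm, h2.trans h4.symm⟩).elim
  · exact ⟨hc1, hc2⟩

/-! ### Edges of a parallelogram in its frame: ends are corners -/

/-- The frame on a corner: `A (x, y) = z + x v + y w`. (Auxiliary.)
[cite: MochizukiAbsTopIII2015, Proposition 2.5 (proof) pp.55–57] -/
theorem frame_apply_mk {z v w : ℂ} {A : ℂ → ℂ}
    (hA : ∀ p : ℂ, A p = z + (p.re : ℂ) * v + (p.im : ℂ) * w) (x y : ℝ) :
    A ⟨x, y⟩ = z + (x : ℂ) * v + (y : ℂ) * w := hA _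

/-- Each edge of the unit square is carried by the frame onto the closed segment between the images
of two distinct corners that share a coordinate. (Auxiliary.)
[cite: MochizukiAbsTopIII2015, Proposition 2.5 (proof) pp.55–57] -/
theorem sq_edge_image_eq_segment {z v w : ℂ} {A : ℂ → ℂ}
    (hA : ∀ p : ℂ, A p = z + (p.re : ℂ) * v + (p.im : ℂ) * w) {E : Set ℂ}
    (hE : E = Icc 0 1 ×ℂ {(0 : ℝ)} ∨ E = Icc 0 1 ×ℂ {(1 : ℝ)} ∨ E = {(0 : ℝ)} ×ℂ Icc 0 1 ∨
      E = {(1 : ℝ)} ×ℂ Icc 0 1) :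
    ∃ x₀ y₀ x₁ y₁ : ℝ, (x₀ = 0 ∨ x₀ = 1) ∧ (y₀ = 0 ∨ y₀ = 1) ∧ (x₁ = 0 ∨ x₁ = 1) ∧
      (y₁ = 0 ∨ y₁ = 1) ∧ ¬ (x₀ = x₁ ∧ y₀ = y₁) ∧ (x₀ = x₁ ∨ y₀ = y₁) ∧
      A '' E = segment ℝ (A ⟨x₀, y₀⟩) (A ⟨x₁, y₁⟩) := by
  rcases hE with rfl | rfl | rfl | rfl
  · refine ⟨0, 0, 1, 0, Or.inl rfl, Or.inl rfl, Or.inr rfl, Or.inl rfl, by norm_num, Or.inr rfl, ?_⟩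
    rw [image_frame_Icc_const hA, frame_apply_mk hA, frame_apply_mk hA]; push_cast; ring_nf
  · refine ⟨0, 1, 1, 1, Or.inl rfl, Or.inr rfl, Or.inr rfl, Or.inr rfl, by norm_num, Or.inr rfl, ?_⟩
    rw [image_frame_Icc_const hA, frame_apply_mk hA, frame_apply_mk hA]; push_cast; ring_nf
  · refine ⟨0, 0, 0, 1, Or.inl rfl, Or.inl rfl, Or.inl rfl, Or.inr rfl, by norm_num, Or.inl rfl, ?_⟩
    rw [image_frame_const_Icc hA, frame_apply_mk hA, frame_apply_mk hA]; push_cast; ring_nf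
  · refine ⟨1, 0, 1, 1, Or.inr rfl, Or.inl rfl, Or.inr rfl, Or.inr rfl, by norm_num, Or.inl rfl, ?_⟩
    rw [image_frame_const_Icc hA, frame_apply_mk hA, frame_apply_mk hA]; push_cast; ring_nf

/-- The frame is injective on corners (indeed everywhere): equal images of `(x, y)`, `(x', y')` force
equal coordinates, for `v, w` independent. (Auxiliary.)
[cite: MochizukiAbsTopIII2015, Proposition 2.5 (proof) pp.55–57] -/
theorem frame_mk_inj {z v w : ℂ} (h : LinearIndependent ℝ ![v, w]) {A : ℂ → ℂ}
    (hA : ∀ p : ℂ, A p = z + (p.re : ℂ) * v + (p.im : ℂ) * w) {x y x' y' : ℝ}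
    (he : A ⟨x, y⟩ = A ⟨x', y'⟩) : x = x' ∧ y = y' := by
  rw [frame_apply_mk hA, frame_apply_mk hA] at he
  have h0 : ((x - x' : ℝ) : ℂ) * v + ((y - y' : ℝ) : ℂ) * w = 0 := by
    push_cast; linear_combination he
  have h1 : (x - x') • v + (y - y') • w = 0 := by
    simpa only [Complex.real_smul] using h0
  have h2 := (LinearIndependent.pair_iff.1 h) (x - x') (y - y') h1
  exact ⟨sub_eq_zero.1 h2.1, sub_eq_zero.1 h2.2⟩

/-- An edge of a non-degenerate parallelogram with closure in `U` lies in `U`. (Auxiliary.)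
[cite: MochizukiAbsTopIII2015, Proposition 2.5 (proof) pp.55–57] -/
theorem sq_edge_image_subset {z v w : ℂ} (h : LinearIndependent ℝ ![v, w]) {U : Set ℂ}
    (hcl : closure (openParallelogram z v w) ⊆ U) {A : ℂ ≃ₜ ℂ}
    (hA : ∀ p : ℂ, A p = z + (p.re : ℂ) * v + (p.im : ℂ) * w) {E : Set ℂ}
    (hE : E = Icc 0 1 ×ℂ {(0 : ℝ)} ∨ E = Icc 0 1 ×ℂ {(1 : ℝ)} ∨ E = {(0 : ℝ)} ×ℂ Icc 0 1 ∨
      E = {(1 : ℝ)} ×ℂ Icc 0 1) : A '' E ⊆ U :=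
  (image_mono (sq_edge_subset_boundary hE)).trans
    ((closure_diff_openParallelogram_eq_image h hA).symm.le.trans (Set.sdiff_subset.trans hcl))

/-- Signed area of two distinct edges through a common corner `(s, t)` of the unit square with far ends
`(a₁, a₂)`, `(b₁, b₂)`: the coordinate determinant is `±1`. (Auxiliary.)
[cite: MochizukiAbsTopIII2015, Proposition 2.5 (proof) pp.55–57] -/
theorem corner_det_sq {s t a₁ a₂ b₁ b₂ : ℝ} (hs : s = 0 ∨ s = 1) (ht : t = 0 ∨ t = 1)
    (ha₁ : a₁ = 0 ∨ a₁ = 1) (ha₂ : a₂ = 0 ∨ a₂ = 1) (hb₁ : b₁ = 0 ∨ b₁ = 1) (hb₂ : b₂ = 0 ∨ b₂ = 1)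
    (hap : ¬ (a₁ = s ∧ a₂ = t)) (hae : a₁ = s ∨ a₂ = t)
    (hbp : ¬ (b₁ = s ∧ b₂ = t)) (hbe : b₁ = s ∨ b₂ = t) (hab : ¬ (a₁ = b₁ ∧ a₂ = b₂)) :
    ((a₁ - s) * (b₂ - t) - (a₂ - t) * (b₁ - s)) ^ 2 = 1 := by
  have ha : (a₁ = 1 - s ∧ a₂ = t) ∨ (a₁ = s ∧ a₂ = 1 - t) := by
    rcases hae with h | h
    · exact Or.inr ⟨h, eq_one_sub_of_ne_of_mem_zero_one ha₂ ht fun h' => hap ⟨h, h'⟩⟩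
    · exact Or.inl ⟨eq_one_sub_of_ne_of_mem_zero_one ha₁ hs fun h' => hap ⟨h', h⟩, h⟩
  have hb : (b₁ = 1 - s ∧ b₂ = t) ∨ (b₁ = s ∧ b₂ = 1 - t) := by
    rcases hbe with h | h
    · exact Or.inr ⟨h, eq_one_sub_of_ne_of_mem_zero_one hb₂ ht fun h' => hbp ⟨h, h'⟩⟩
    · exact Or.inl ⟨eq_one_sub_of_ne_of_mem_zero_one hb₁ hs fun h' => hbp ⟨h', h⟩, h⟩
  rcases ha with ⟨rfl, rfl⟩ | ⟨rfl, rfl⟩ <;> rcases hb with ⟨rfl, rfl⟩ | ⟨rfl, rfl⟩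
  · exact (hab ⟨rfl, rfl⟩).elim
  · rcases hs with rfl | rfl <;> rcases ht with rfl | rfl <;> norm_num
  · rcases hs with rfl | rfl <;> rcases ht with rfl | rfl <;> norm_num
  · exact (hab ⟨rfl, rfl⟩).elim

/-! ### Prop 2.5 (e): sides with prescribed endpoints -/

section LocalAdd

variable {U : Set ℂ}

/-- The recovered collection inherits the standing hypotheses `𝒮(U) ⊆ · ⊆ 𝒫(U)` once it is known to be
`𝒫(U)`. (Auxiliary.) [cite: MochizukiAbsTopIII2015, Proposition 2.5 (c) p.56] -/
theorem Parallelograms.hyps_of_parallelograms_eq {𝒬 : Set (Set U)}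
    (H : Parallelograms.parallelograms 𝒬 = {P : Set U | Subtype.val '' P ∈ parallelogramsIn U}) :
    (∀ Q ∈ Parallelograms.parallelograms 𝒬, Subtype.val '' Q ∈ parallelogramsIn U) ∧
      ∀ Q : Set U, Subtype.val '' Q ∈ squaresIn U → Q ∈ Parallelograms.parallelograms 𝒬 := by
  rw [H]
  exact ⟨fun Q h => h, fun Q h => squaresIn_subset_parallelogramsIn U h⟩

/-- **A side with endpoints `{p, a}`.** For a recovered parallelogram `P` (frame `A`), a side `S` of
`P` whose endpoints are `{p, a}` is the segment `[p, a]`, and `p`, `a` are the images of two distinct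
corners of the unit square sharing a coordinate (in particular `a ≠ p`). (Auxiliary.)
[cite: MochizukiAbsTopIII2015, Proposition 2.5 (e) p.57] -/
theorem Parallelograms.exists_corners_of_isSide (hU : IsOpen U) {𝒬 : Set (Set U)}
    (h𝒬 : ∀ Q ∈ 𝒬, Subtype.val '' Q ∈ parallelogramsIn U)
    (h𝒮 : ∀ Q : Set U, Subtype.val '' Q ∈ squaresIn U → Q ∈ 𝒬)
    (H : Parallelograms.parallelograms 𝒬 = {P : Set U | Subtype.val '' P ∈ parallelogramsIn U})
    {P : Set U} (hP : P ∈ Parallelograms.parallelograms 𝒬) {z v w : ℂ}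
    (hPe : Subtype.val '' P = openParallelogram z v w) (hvw : LinearIndependent ℝ ![v, w])
    (hcl : closure (openParallelogram z v w) ⊆ U) {A : ℂ ≃ₜ ℂ}
    (hA : ∀ q : ℂ, A q = z + (q.re : ℂ) * v + (q.im : ℂ) * w) {S : Set U}
    (hS : Parallelograms.IsSide (Parallelograms.parallelograms 𝒬) P S) {p a : U}
    (hpa : Parallelograms.endpoints 𝒬 S = {p, a}) :
    ∃ x₀ y₀ x₁ y₁ : ℝ, (x₀ = 0 ∨ x₀ = 1) ∧ (y₀ = 0 ∨ y₀ = 1) ∧ (x₁ = 0 ∨ x₁ = 1) ∧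
      (y₁ = 0 ∨ y₁ = 1) ∧ ¬ (x₀ = x₁ ∧ y₀ = y₁) ∧ (x₀ = x₁ ∨ y₀ = y₁) ∧
      (p : ℂ) = A ⟨x₀, y₀⟩ ∧ (a : ℂ) = A ⟨x₁, y₁⟩ ∧ Subtype.val '' S = segment ℝ (p : ℂ) a := by
  obtain ⟨h𝒬', h𝒮'⟩ := Parallelograms.hyps_of_parallelograms_eq H
  obtain ⟨E, hE, rfl⟩ := (Parallelograms.isSide_iff_of_subset hU h𝒬' h𝒮' hP hPe hvw hcl hA).1 hS
  obtain ⟨x₀, y₀, x₁, y₁, hx₀, hy₀, hx₁, hy₁, hne, hsh, hAE⟩ :=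
    sq_edge_image_eq_segment (A := A) hA hE
  have hEU : A '' E ⊆ U := sq_edge_image_subset hvw hcl hA hE
  have hval : Subtype.val '' (Subtype.val ⁻¹' (A '' E) : Set U) = A '' E := by
    rw [image_preimage_eq_inter_range, Subtype.range_coe, inter_eq_left.2 hEU]
  have hends : A ⟨x₀, y₀⟩ ≠ A ⟨x₁, y₁⟩ := fun he => hne (frame_mk_inj hvw hA he)
  have him := Parallelograms.image_val_endpoints_eq_of_subset hU h𝒬 h𝒮 hends (hval.trans hAE)
  rw [hpa, image_pair] at him
  rcases pair_eq_pair_iff.1 him with ⟨hp0, ha1⟩ | ⟨hp1, ha0⟩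
  · exact ⟨x₀, y₀, x₁, y₁, hx₀, hy₀, hx₁, hy₁, hne, hsh, hp0, ha1, by rw [hval, hAE, hp0, ha1]⟩
  · refine ⟨x₁, y₁, x₀, y₀, hx₁, hy₁, hx₀, hy₀, fun h => hne ⟨h.1.symm, h.2.symm⟩,
      hsh.elim (fun h => Or.inl h.symm) (fun h => Or.inr h.symm), hp1, ha0, ?_⟩
    rw [hval, hAE, hp1, ha0, segment_symm]

/-- **[AbsTopIII] Prop 2.5 (e), degenerate cases**: `p +_p b = b`.
[cite: MochizukiAbsTopIII2015, Proposition 2.5 (e) p.57] -/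
theorem Parallelograms.localAdd_pt_left_iff {𝒬 : Set (Set U)} (p b c : U) :
    Parallelograms.LocalAdd 𝒬 p p b c ↔ c = b := by
  unfold Parallelograms.LocalAdd
  constructor
  · rintro (⟨-, h⟩ | ⟨hb, hc⟩ | ⟨h, -⟩)
    · exact h
    · rw [hc, hb]
    · exact (h rfl).elim
  · exact fun h => Or.inl ⟨rfl, h⟩

/-- **[AbsTopIII] Prop 2.5 (e), degenerate cases**: `a +_p p = a`.
[cite: MochizukiAbsTopIII2015, Proposition 2.5 (e) p.57] -/
theorem Parallelograms.localAdd_pt_right_iff {𝒬 : Set (Set U)} (p a c : U) :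
    Parallelograms.LocalAdd 𝒬 p a p c ↔ c = a := by
  unfold Parallelograms.LocalAdd
  constructor
  · rintro (⟨ha, hc⟩ | ⟨-, h⟩ | ⟨-, h, -⟩)
    · rw [hc, ha]
    · exact h
    · exact (h rfl).elim
  · exact fun h => Or.inr (Or.inl ⟨rfl, h⟩)

/-- **[AbsTopIII] Prop 2.5 (e) is the parallelogram law.** For `U ⊆ ℂ` open, `𝒮(U) ⊆ 𝒬 ⊆ 𝒫(U)` and
granted the Prop 2.5 (c) reconstruction `parallelograms 𝒬 = 𝒫(U)` (first clause of
`TwoOrientations`): if `a, b ≠ p` and `c = a +_p b` in the sense of the (U, 𝒬(U))-algorithm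
(`Parallelograms.LocalAdd`), then `c = a + b − p` in `ℂ`, and `a − p`, `b − p` are `ℝ`-linearly
independent (the witnessing sides `S_a ∋ a`, `S_b ∋ b` are distinct edges through the corner `p` of a
genuine parallelogram). [cite: MochizukiAbsTopIII2015, Proposition 2.5 (e) p.57] -/
theorem Parallelograms.coe_eq_of_localAdd (hU : IsOpen U) {𝒬 : Set (Set U)}
    (h𝒬 : ∀ Q ∈ 𝒬, Subtype.val '' Q ∈ parallelogramsIn U)
    (h𝒮 : ∀ Q : Set U, Subtype.val '' Q ∈ squaresIn U → Q ∈ 𝒬)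
    (H : Parallelograms.parallelograms 𝒬 = {P : Set U | Subtype.val '' P ∈ parallelogramsIn U})
    {p a b c : U} (ha : a ≠ p) (hb : b ≠ p) (h : Parallelograms.LocalAdd 𝒬 p a b c) :
    (c : ℂ) = a + b - p ∧ LinearIndependent ℝ ![(a : ℂ) - p, (b : ℂ) - p] := by
  rcases h with ⟨hap, -⟩ | ⟨hbp, -⟩ | ⟨-, -, P, hP, Sa, Sb, hSa, hSb, hSab, hea, heb, hc, ⟨S, hS, hcS⟩, -⟩
  · exact (ha hap).elim
  · exact (hb hbp).elim
  obtain ⟨h𝒬', h𝒮'⟩ := Parallelograms.hyps_of_parallelograms_eq H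
  -- the parallelogram and its frame
  have hP' : Subtype.val '' P ∈ parallelogramsIn U := h𝒬' P hP
  obtain ⟨z, v, w, hvw, hPe, hcl⟩ := hP'
  rw [hPe] at hcl
  obtain ⟨A, hA⟩ := exists_homeomorph_frame z v w hvw
  -- the two sides through `p`
  obtain ⟨x₀, y₀, x₁, y₁, hx₀, hy₀, hx₁, hy₁, hne₁, hsh₁, hp₀, ha₁, hSa_eq⟩ :=
    Parallelograms.exists_corners_of_isSide hU h𝒬 h𝒮 H hP hPe hvw hcl hA hSa hea
  obtain ⟨x₀', y₀', x₂, y₂, hx₀', hy₀', hx₂, hy₂, hne₂, hsh₂, hp₀', hb₂, hSb_eq⟩ :=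
    Parallelograms.exists_corners_of_isSide hU h𝒬 h𝒮 H hP hPe hvw hcl hA hSb heb
  obtain ⟨rfl, rfl⟩ : x₀ = x₀' ∧ y₀ = y₀' := frame_mk_inj hvw hA (hp₀.symm.trans hp₀')
  -- `a ≠ b`: otherwise `S_a = S_b = S_a ∩ S_b = {p}` would be finite
  have hpa : (p : ℂ) ≠ a := fun h => ha (Subtype.ext h.symm)
  have hab : ¬ (x₁ = x₂ ∧ y₁ = y₂) := by
    rintro ⟨rfl, rfl⟩
    have hab' : (a : ℂ) = b := ha₁.trans hb₂.symm
    have hSS : Sa = Sb :=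
      Subtype.val_injective.image_injective (by rw [hSa_eq, hSb_eq, hab'])
    have hfin : (Subtype.val '' Sa).Finite := by
      rw [show Sa = {p} by rw [← hSab, ← hSS, inter_self], image_singleton]
      exact finite_singleton _
    exact segment_infinite hpa (hSa_eq ▸ hfin)
  -- `c` is a corner
  obtain ⟨Ec, hEc, rfl⟩ := (Parallelograms.isSide_iff_of_subset hU h𝒬' h𝒮' hP hPe hvw hcl hA).1 hS
  obtain ⟨u₀, v₀, u₁, v₁, hu₀, hv₀, hu₁, hv₁, hneE, -, hAEc⟩ :=
    sq_edge_image_eq_segment (A := A) hA hEc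
  have hEcU : A '' Ec ⊆ U := sq_edge_image_subset hvw hcl hA hEc
  have hvalc : Subtype.val '' (Subtype.val ⁻¹' (A '' Ec) : Set U) = A '' Ec := by
    rw [image_preimage_eq_inter_range, Subtype.range_coe, inter_eq_left.2 hEcU]
  have hendsE : A ⟨u₀, v₀⟩ ≠ A ⟨u₁, v₁⟩ := fun he => hneE (frame_mk_inj hvw hA he)
  rw [Parallelograms.endpoints_eq_of_subset hU h𝒬 h𝒮 hendsE (hvalc.trans hAEc)] at hcS
  obtain ⟨-, hcS⟩ := hcS
  simp only [mem_preimage, mem_insert_iff, mem_singleton_iff] at hcS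
  -- pick the corner coordinates of `c`
  obtain ⟨xc, yc, hxc, hyc, hcc⟩ : ∃ xc yc : ℝ, (xc = 0 ∨ xc = 1) ∧ (yc = 0 ∨ yc = 1) ∧
      (c : ℂ) = A ⟨xc, yc⟩ := by
    rcases hcS with h | h
    · exact ⟨u₀, v₀, hu₀, hv₀, h⟩
    · exact ⟨u₁, v₁, hu₁, hv₁, h⟩
  -- the excluded corners
  simp only [mem_insert_iff, mem_singleton_iff, not_or] at hc
  obtain ⟨hca, hcb, hcp⟩ := hc
  have hcp' : ¬ (xc = x₀ ∧ yc = y₀) := by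
    rintro ⟨rfl, rfl⟩; exact hcp (Subtype.ext (hcc.trans hp₀.symm))
  have hca' : ¬ (xc = x₁ ∧ yc = y₁) := by
    rintro ⟨rfl, rfl⟩; exact hca (Subtype.ext (hcc.trans ha₁.symm))
  have hcb' : ¬ (xc = x₂ ∧ yc = y₂) := by
    rintro ⟨rfl, rfl⟩; exact hcb (Subtype.ext (hcc.trans hb₂.symm))
  have hap' : ¬ (x₁ = x₀ ∧ y₁ = y₀) := fun h => hne₁ ⟨h.1.symm, h.2.symm⟩
  have hae' : x₁ = x₀ ∨ y₁ = y₀ := hsh₁.elim (fun h => Or.inl h.symm) fun h => Or.inr h.symm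
  have hbp' : ¬ (x₂ = x₀ ∧ y₂ = y₀) := fun h => hne₂ ⟨h.1.symm, h.2.symm⟩
  have hbe' : x₂ = x₀ ∨ y₂ = y₀ := hsh₂.elim (fun h => Or.inl h.symm) fun h => Or.inr h.symm
  obtain ⟨hx, hy⟩ := corner_fourth hx₀ hy₀ hx₁ hy₁ hx₂ hy₂ hxc hyc hap' hae' hbp' hbe' hab hcp' hca' hcb'
  have hdet := corner_det_sq hx₀ hy₀ hx₁ hy₁ hx₂ hy₂ hap' hae' hbp' hbe' hab
  refine ⟨?_, ?_⟩
  · rw [hcc, ha₁, hb₂, hp₀, frame_apply_mk hA, frame_apply_mk hA, frame_apply_mk hA,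
      frame_apply_mk hA, hx, hy]
    push_cast
    ring
  · rw [linearIndependent_pair_iff_det] at hvw ⊢
    rw [ha₁, hb₂, hp₀, frame_apply_mk hA, frame_apply_mk hA, frame_apply_mk hA]
    simp only [add_re, add_im, sub_re, sub_im, mul_re, mul_im, ofReal_re, ofReal_im, zero_mul,
      sub_zero]
    have key : ((x₁ : ℝ) * v.re + y₁ * w.re - (x₀ * v.re + y₀ * w.re)) *
          (x₂ * v.im + y₂ * w.im - (x₀ * v.im + y₀ * w.im)) -
        (x₁ * v.im + y₁ * w.im - (x₀ * v.im + y₀ * w.im)) *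
          (x₂ * v.re + y₂ * w.re - (x₀ * v.re + y₀ * w.re)) =
        ((x₁ - x₀) * (y₂ - y₀) - (y₁ - y₀) * (x₂ - x₀)) * (v.re * w.im - v.im * w.re) := by ring
    intro h0
    have h1 : ((x₁ - x₀) * (y₂ - y₀) - (y₁ - y₀) * (x₂ - x₀)) * (v.re * w.im - v.im * w.re) = 0 := by
      rw [← key]
      linear_combination h0
    rcases mul_eq_zero.1 h1 with h2 | h2
    · rw [h2] at hdet; norm_num at hdet
    · exact hvw h2

end LocalAdd

end

end Literature.AnabelianGeometry.AbsoluteAnabelian
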